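import Mathlib
import Summits.Ventures.HodgeRepro.Tier4.Common.CompactOpenLevel
import Summits.Ventures.HodgeRepro.Tier4.Line4.FinitePlacePositivity
import Summits.Ventures.HodgeRepro.Tier4.Line4.FiniteSum
import Summits.Ventures.HodgeRepro.Tier4.Line4.IntegProper
import Summits.Ventures.HodgeRepro.Tier4.Line4.HorbMain

/-!
# Tier4/Line4/LevelVolume — C-L4-LEVELVOL: the natural finite witness `ffinLevel` of the level family, its main term
`≥ δ` with NO volume input, and the ONE display the `L¹`-clause needs (the dimension count)

Blind re-derivation cell `pub-hodge-repro`, Tier 4 «prove the step» (README §9–§10), seat t4-L2-p1 (gen 3; L4 service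
prover; lead (R-26) S15038 «state crit-1 Entry 119's count lemma», taken S15055).  Tree path
`lean/Summits/Ventures/HodgeRepro/Tier4/Line4/LevelVolume.lean`.  Imports `Line4/HorbMain` (p701801, the quantitative
FINSUM), `Line4/IntegProper` (p698134, the closed embedding `T_f ↪ G(𝔸)`), `Line4/FiniteSum` (p697806, the open traces),
`Line4/FinitePlacePositivity` (`levelDoubleCoset`), `Common/CompactOpenLevel` (`levelK`, `finCongr`, `preimage_levelK_eq`).
Mathlib-level; no literature.

THE OBJECTS.  `levelTf W N := {b ∈ T_f | b ∈ K(N)}`, `levelTf' W N` (the traces of the principal congruence subgroup on the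
finite tori: open, compact, `∋ 1`, hence of POSITIVE FINITE Haar measure), `levelNorm W νf νf' N := ν_f(levelTf N) ·
ν′_f(levelTf′ N)` and **the natural finite witness** `ffinLevel W νf νf' γ₀ N x := levelNorm⁻¹ · 1[x_f ∈ K(N) γ₀,f K(N)]`
(read through `GA.ofFinPart`, so that it is CONTINUOUS on `G(𝔸)`: the set `{x | x_f ∈ K(N) γ₀,f K(N)}` is clopen — closed
as the preimage of a compact, open because on `G(𝔸_f)` the level subgroup is the trace of the open `finCongr N`).

THE STATEMENTS.  (a) `ffinLevel` is real, non-negative, continuous, supported (on `G(𝔸_f)`) in the compact double coset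
and depends on `x` through `x_f` only — the binders `hreal hnonneg hFfinc Cf hCf hFsupp` of `horb_of_integ_definite` /
`norm_orbital_ge_of_chain` for the level family, discharged.  (b) **`re_setIntegral_chi_innerFin_ffinLevel_ge`**: the FINITE
MAIN TERM IS `≥ δ`, uniformly in the level, as soon as `levelTf N ⊆ DZ_f` (ZDOMAIN-EX (iii): `DZ_f ⊇ U ∋ 1`, and the traces
shrink to `1`) and `Re (χ conj χ′) ≥ δ ≥ 0` on the support (FINPOS′ with a margin) — the `T`-normalisation cancels the
measure of `levelTf × levelTf′ ⊆ {(b, b′) : b⁻¹ γ₀,f b′ ∈ K(N) γ₀,f K(N)}`: NO VOLUME INPUT.  (c) **`LevelVolumeComparison`**,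
the ONE display: `∃ M, ∀ N ≠ 0, μ_f(K(N) γ₀,f K(N)) ≤ M · levelNorm N` for a Haar measure `μ_f` on `G(𝔸_f)` — the dimension
count `dim G = dim T + dim T′` (`4 = 2 + 2`: `vol K(N) ≍ N^{−4d}`, `vol (T ∩ K(N)) ≍ N^{−2d}`) with the double-coset index
bounded (crit-1 Entry 119, S15031); its corollary `setLIntegral_norm_ffinLevel_le`: `∫_{G(𝔸_f)} ‖ffinLevel N‖ dμ_f ≤ M`,
the `L¹` clause of `TailFamily'` on the natural witness.  So the level family's finite side is priced by exactly one
display, and the main term `hmain` of the TAIL assembly reads `m := c c′ ‖arch‖ δ` through `norm_orbital_ge_of_chain`.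

Nothing here says anything about the status of the Hodge conjecture for CM abelian varieties, which is NOT proved
(HC_CM is NOT proved by anyone in this repository).
-/

set_option autoImplicit false
noncomputable section
namespace Summit.Ventures.HodgeRepro.Tier4.Line4
open Summit.Ventures.HodgeRepro.Tier4 Summit.Ventures.HodgeRepro.Tier4.Common
  Summit.Ventures.HodgeRepro.Tier4.Line1 MeasureTheory
open scoped ComplexConjugate Topology Pointwise NNReal ENNReal

/-! ## The traces of `K(N)` on the finite tori -/

section Traces
variable {k : Type} [Field k] [NumberField k] (W : PlaneData k)

/-- The trace of `K(N)` on `T_f`. -/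
def levelTf (N : ℕ) : Set (torusFin W) := {b | ((b : torusT W) : GA W) ∈ levelK W N}

/-- The trace of `K(N)` on `T′_f`. -/
def levelTf' (N : ℕ) : Set (torusFin' W) := {b | ((b : torusT' W) : GA W) ∈ levelK W N}

/-- The trace on `T_f` is open (`N ≠ 0`; FINSUPP). -/
theorem isOpen_levelTf {N : ℕ} (hN : N ≠ 0) : IsOpen (levelTf W N) := isOpen_coe_mem_levelK W hN

/-- The trace on `T′_f` is open (`N ≠ 0`; FINSUPP). -/
theorem isOpen_levelTf' {N : ℕ} (hN : N ≠ 0) : IsOpen (levelTf' W N) := isOpen_coe_mem_levelK' W hN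

/-- The trace on `T_f` is compact: the preimage of the compact `K(N)` under the closed embedding `T_f ↪ G(𝔸)`. -/
theorem isCompact_levelTf {N : ℕ} (hN : N ≠ 0) : IsCompact (levelTf W N) :=
  (isClosedEmbedding_torusFin_coe W).isCompact_preimage (isCompact_levelK W hN)

/-- The trace on `T′_f` is compact. -/
theorem isCompact_levelTf' {N : ℕ} (hN : N ≠ 0) : IsCompact (levelTf' W N) :=
  (isClosedEmbedding_torusFin'_coe W).isCompact_preimage (isCompact_levelK W hN)

/-- `1 ∈ levelTf N`. -/
theorem one_mem_levelTf (N : ℕ) : (1 : torusFin W) ∈ levelTf W N := by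
  show ((((1 : torusFin W) : torusT W)) : GA W) ∈ levelK W N
  simp only [OneMemClass.coe_one]
  exact one_mem _

/-- `1 ∈ levelTf′ N`. -/
theorem one_mem_levelTf' (N : ℕ) : (1 : torusFin' W) ∈ levelTf' W N := by
  show ((((1 : torusFin' W) : torusT' W)) : GA W) ∈ levelK W N
  simp only [OneMemClass.coe_one]
  exact one_mem _

/-- The trace is measurable. -/
theorem measurableSet_levelTf [MeasurableSpace (GA W)] [BorelSpace (GA W)] {N : ℕ} (hN : N ≠ 0) :
    MeasurableSet (levelTf W N) := by
  haveI : BorelSpace (torusT W) := Subtype.borelSpace _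
  haveI : BorelSpace (torusFin W) := Subtype.borelSpace _
  exact (isOpen_levelTf W hN).measurableSet

/-- The primed trace is measurable. -/
theorem measurableSet_levelTf' [MeasurableSpace (GA W)] [BorelSpace (GA W)] {N : ℕ} (hN : N ≠ 0) :
    MeasurableSet (levelTf' W N) := by
  haveI : BorelSpace (torusT' W) := Subtype.borelSpace _
  haveI : BorelSpace (torusFin' W) := Subtype.borelSpace _
  exact (isOpen_levelTf' W hN).measurableSet

end Traces

/-! ## The level normalisation and the natural witness -/

section Witness
variable {k : Type} [Field k] [NumberField k] (W : PlaneData k) [MeasurableSpace (GA W)]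

/-- **The level normalisation** `n_N := ν_f(T_f ∩ K(N)) · ν′_f(T′_f ∩ K(N))`. -/
def levelNorm (νf : Measure (torusFin W)) (νf' : Measure (torusFin' W)) (N : ℕ) : ℝ :=
  (νf (levelTf W N)).toReal * (νf' (levelTf' W N)).toReal

/-- The trace has positive finite Haar measure (open, non-empty, compact). -/
theorem measure_levelTf_pos_lt_top (νf : Measure (torusFin W)) [νf.IsHaarMeasure] {N : ℕ} (hN : N ≠ 0) :
    0 < νf (levelTf W N) ∧ νf (levelTf W N) < ⊤ :=
  ⟨(isOpen_levelTf W hN).measure_pos νf ⟨1, one_mem_levelTf W N⟩,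
    (isCompact_levelTf W hN).measure_lt_top⟩

/-- The primed trace has positive finite Haar measure. -/
theorem measure_levelTf'_pos_lt_top (νf' : Measure (torusFin' W)) [νf'.IsHaarMeasure] {N : ℕ} (hN : N ≠ 0) :
    0 < νf' (levelTf' W N) ∧ νf' (levelTf' W N) < ⊤ :=
  ⟨(isOpen_levelTf' W hN).measure_pos νf' ⟨1, one_mem_levelTf' W N⟩,
    (isCompact_levelTf' W hN).measure_lt_top⟩

/-- The level normalisation is positive. -/
theorem levelNorm_pos (νf : Measure (torusFin W)) [νf.IsHaarMeasure] (νf' : Measure (torusFin' W))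
    [νf'.IsHaarMeasure] {N : ℕ} (hN : N ≠ 0) : 0 < levelNorm W νf νf' N := by
  obtain ⟨h1, h2⟩ := measure_levelTf_pos_lt_top W νf hN
  obtain ⟨h3, h4⟩ := measure_levelTf'_pos_lt_top W νf' hN
  exact mul_pos (ENNReal.toReal_pos h1.ne' h2.ne) (ENNReal.toReal_pos h3.ne' h4.ne)

/-- **The natural finite witness of the level family**: `levelNorm⁻¹ · 1[x_f ∈ K(N) γ₀,f K(N)]`, read through the
finite part so that it is a continuous function on `G(𝔸)` depending on `x_f` only. -/
def ffinLevel (νf : Measure (torusFin W)) (νf' : Measure (torusFin' W)) (γ₀ : GA W) (N : ℕ) (x : GA W) : ℂ :=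
  (((levelNorm W νf νf' N)⁻¹ : ℝ) : ℂ) *
    (levelDoubleCoset W N (GA.ofFinPart W γ₀)).indicator (fun _ => (1 : ℂ)) (GA.ofFinPart W x)

variable (νf : Measure (torusFin W)) (νf' : Measure (torusFin' W)) (γ₀ : GA W) (N : ℕ)

/-- `ffinLevel` is real. -/
theorem ffinLevel_im (x : GA W) : (ffinLevel W νf νf' γ₀ N x).im = 0 := by
  unfold ffinLevel
  by_cases h : GA.ofFinPart W x ∈ levelDoubleCoset W N (GA.ofFinPart W γ₀)
  · rw [Set.indicator_of_mem h, mul_one, Complex.ofReal_im]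
  · rw [Set.indicator_of_notMem h, mul_zero, Complex.zero_im]

/-- `ffinLevel` is non-negative (`levelNorm > 0`). -/
theorem ffinLevel_re_nonneg [νf.IsHaarMeasure] [νf'.IsHaarMeasure] (hN : N ≠ 0) (x : GA W) :
    0 ≤ (ffinLevel W νf νf' γ₀ N x).re := by
  unfold ffinLevel
  by_cases h : GA.ofFinPart W x ∈ levelDoubleCoset W N (GA.ofFinPart W γ₀)
  · rw [Set.indicator_of_mem h, mul_one, Complex.ofReal_re]
    exact (inv_pos.2 (levelNorm_pos W νf νf' hN)).le
  · rw [Set.indicator_of_notMem h, mul_zero, Complex.zero_re]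

/-- `ffinLevel` depends on `x` through its finite part only. -/
theorem ffinLevel_ofFinPart (x : GA W) : ffinLevel W νf νf' γ₀ N (GA.ofFinPart W x) = ffinLevel W νf νf' γ₀ N x := by
  unfold ffinLevel
  rw [ofFinPart_eq_self_of_mem_finitePart W (ofFinPart_mem_finitePart W x)]

/-- On `G(𝔸_f)`, `ffinLevel ≠ 0` only on the compact double coset (`hFsupp` with `Cf := levelDoubleCoset`). -/
theorem mem_levelDoubleCoset_of_ffinLevel_ne_zero {g : GA W} (hg : g ∈ finitePart W)
    (h : ffinLevel W νf νf' γ₀ N g ≠ 0) : g ∈ levelDoubleCoset W N (GA.ofFinPart W γ₀) := by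
  unfold ffinLevel at h
  rw [ofFinPart_eq_self_of_mem_finitePart W hg] at h
  by_contra hmem
  exact h (by rw [Set.indicator_of_notMem hmem, mul_zero])

/-- The value on the double coset: `levelNorm⁻¹`. -/
theorem ffinLevel_of_mem {g : GA W} (hg : g ∈ finitePart W) (h : g ∈ levelDoubleCoset W N (GA.ofFinPart W γ₀)) :
    ffinLevel W νf νf' γ₀ N g = (((levelNorm W νf νf' N)⁻¹ : ℝ) : ℂ) := by
  unfold ffinLevel
  rw [ofFinPart_eq_self_of_mem_finitePart W hg, Set.indicator_of_mem h, mul_one]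

omit [MeasurableSpace (GA W)] in
/-- The preimage of the double coset under the finite-part projection is the preimage of the OPEN set
`K(N) · γ₀,f · finCongr N` (on `G(𝔸_f)` the level subgroup is the trace of `finCongr N`). -/
theorem preimage_ofFinPart_levelDoubleCoset :
    GA.ofFinPart W ⁻¹' levelDoubleCoset W N (GA.ofFinPart W γ₀) =
      GA.ofFinPart W ⁻¹' ((levelK W N : Set (GA W)) * {GA.ofFinPart W γ₀} * finCongr W N) := by
  have hKF : ∀ {y : GA W}, y ∈ finitePart W → (y ∈ levelK W N ↔ y ∈ finCongr W N) := by
    intro y hy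
    have h := congrArg (fun S : Set (finitePart W) => (⟨y, hy⟩ : finitePart W) ∈ S) (preimage_levelK_eq W N)
    simpa only [Set.mem_preimage, SetLike.mem_coe, eq_iff_iff] using h
  ext x
  simp only [Set.mem_preimage, levelDoubleCoset]
  constructor
  · intro hx
    obtain ⟨a, ha, c, hc, hx⟩ := exists_eq_mul_of_mem_mul_singleton_mul W _ _ _ hx
    rw [hx]
    exact Set.mul_mem_mul (Set.mul_mem_mul ha (Set.mem_singleton _)) ((hKF (levelK_le_finitePart W N hc)).1 hc)
  · intro hx
    obtain ⟨u, hu, c, hc, hx⟩ := Set.mem_mul.1 hx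
    obtain ⟨a, ha, γ, hγ, hu'⟩ := Set.mem_mul.1 hu
    rw [Set.mem_singleton_iff] at hγ
    subst hγ
    rw [← hu'] at hx
    -- `c = (a γ₀,f)⁻¹ x_f ∈ G(𝔸_f)`, hence in `K(N)`
    have hcfin : c ∈ finitePart W := by
      have : c = (a * GA.ofFinPart W γ₀)⁻¹ * GA.ofFinPart W x := by rw [← hx]; group
      rw [this]
      exact (finitePart W).mul_mem ((finitePart W).inv_mem ((finitePart W).mul_mem (levelK_le_finitePart W N ha)
        (ofFinPart_mem_finitePart W γ₀))) (ofFinPart_mem_finitePart W x)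
    rw [← hx]
    exact Set.mul_mem_mul (Set.mul_mem_mul ha (Set.mem_singleton _)) ((hKF hcfin).2 hc)

omit [MeasurableSpace (GA W)] in
/-- The set `{x | x_f ∈ K(N) γ₀,f K(N)}` is clopen in `G(𝔸)`. -/
theorem isClopen_preimage_ofFinPart_levelDoubleCoset (hN : N ≠ 0) :
    IsClopen (GA.ofFinPart W ⁻¹' levelDoubleCoset W N (GA.ofFinPart W γ₀)) := by
  haveI : T2Space (GA W) := t2Space_GA W
  refine ⟨(isCompact_levelDoubleCoset W hN _).isClosed.preimage (continuous_ofFinPart W), ?_⟩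
  rw [preimage_ofFinPart_levelDoubleCoset W γ₀ N]
  exact ((isOpen_finCongr W hN).mul_left).preimage (continuous_ofFinPart W)

/-- **`ffinLevel` is continuous on `G(𝔸)`** (a constant times the indicator of a clopen set). -/
theorem continuous_ffinLevel (hN : N ≠ 0) : Continuous (ffinLevel W νf νf' γ₀ N) := by
  have hind : ffinLevel W νf νf' γ₀ N = fun x : GA W => (((levelNorm W νf νf' N)⁻¹ : ℝ) : ℂ) *
      (GA.ofFinPart W ⁻¹' levelDoubleCoset W N (GA.ofFinPart W γ₀)).indicator (fun _ => (1 : ℂ)) x := by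
    funext x
    unfold ffinLevel
    by_cases h : GA.ofFinPart W x ∈ levelDoubleCoset W N (GA.ofFinPart W γ₀)
    · rw [Set.indicator_of_mem h, Set.indicator_of_mem (Set.mem_preimage.2 h)]
    · rw [Set.indicator_of_notMem h, Set.indicator_of_notMem (fun h' => h (Set.mem_preimage.1 h'))]
  rw [hind]
  exact continuous_const.mul
    ((isClopen_preimage_ofFinPart_levelDoubleCoset W γ₀ N hN).continuous_indicator continuous_const)

/-! ## The main term of the natural witness is `≥ δ` — no volume input -/

omit [MeasurableSpace (GA W)] in
/-- The orbit value of a pair in `levelTf × levelTf′` lies in the double coset. -/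
theorem orbit_mem_levelDoubleCoset_of_mem {b : torusFin W} {b' : torusFin' W} (hb : b ∈ levelTf W N)
    (hb' : b' ∈ levelTf' W N) :
    (((b : torusT W) : GA W))⁻¹ * GA.ofFinPart W γ₀ * ((b' : torusT' W) : GA W) ∈
      levelDoubleCoset W N (GA.ofFinPart W γ₀) :=
  Set.mul_mem_mul (Set.mul_mem_mul (inv_mem hb) (Set.mem_singleton _)) hb'

omit [MeasurableSpace (GA W)] in
/-- The orbit value of a pair of finite-torus elements lies in `G(𝔸_f)`. -/
theorem orbit_mem_finitePart (b : torusFin W) (b' : torusFin' W) :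
    (((b : torusT W) : GA W))⁻¹ * GA.ofFinPart W γ₀ * ((b' : torusT' W) : GA W) ∈ finitePart W :=
  (finitePart W).mul_mem ((finitePart W).mul_mem ((finitePart W).inv_mem (Subgroup.mem_subgroupOf.1 b.2))
    (ofFinPart_mem_finitePart W γ₀)) (Subgroup.mem_subgroupOf.1 b'.2)

variable [BorelSpace (GA W)] (R : RTFData W)

/-- `F_f ∘ orbit` is integrable on `DZ_f × T′_f` as soon as `χ conj χ′ · F_f ∘ orbit` is (`|χ| = |χ′| = 1`). -/
theorem integrableOn_ffinLevel_orbit_of_hint [νf.IsHaarMeasure] [νf'.IsHaarMeasure]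
    (hc : Continuous R.chi) (hu : ∀ a, ‖R.chi a‖ = 1) (hc' : Continuous R.chi') (hu' : ∀ a, ‖R.chi' a‖ = 1)
    (DZf : Set (torusFin W))
    (hint : IntegrableOn (fun p : torusFin W × torusFin' W => R.chi p.1 * conj (R.chi' p.2) *
      ffinLevel W νf νf' γ₀ N ((((p.1 : torusT W) : GA W))⁻¹ * GA.ofFinPart W γ₀ * ((p.2 : torusT' W) : GA W)))
      (DZf ×ˢ Set.univ) (νf.prod νf')) :
    IntegrableOn (fun p : torusFin W × torusFin' W =>
      ffinLevel W νf νf' γ₀ N ((((p.1 : torusT W) : GA W))⁻¹ * GA.ofFinPart W γ₀ * ((p.2 : torusT' W) : GA W)))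
      (DZf ×ˢ Set.univ) (νf.prod νf') := by
  haveI : BorelSpace (torusT W) := Subtype.borelSpace _
  haveI : BorelSpace (torusT' W) := Subtype.borelSpace _
  haveI : BorelSpace (torusFin W) := Subtype.borelSpace _
  haveI : BorelSpace (torusFin' W) := Subtype.borelSpace _
  haveI : SecondCountableTopology (torusFin W) := secondCountable_torusFin W
  haveI : SecondCountableTopology (torusFin' W) := secondCountable_torusFin' W
  haveI : BorelSpace (torusFin W × torusFin' W) := Prod.borelSpace
  set Fo : torusFin W × torusFin' W → ℂ := fun p =>
    ffinLevel W νf νf' γ₀ N ((((p.1 : torusT W) : GA W))⁻¹ * GA.ofFinPart W γ₀ * ((p.2 : torusT' W) : GA W)) with hFo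
  have hbd : IntegrableOn (fun p : torusFin W × torusFin' W => (conj (R.chi p.1) * R.chi' p.2) *
      (R.chi p.1 * conj (R.chi' p.2) * Fo p)) (DZf ×ˢ Set.univ) (νf.prod νf') := by
    refine hint.bdd_mul (c := 1) ?_ (Filter.Eventually.of_forall fun p => ?_)
    · refine Continuous.aestronglyMeasurable ?_
      exact (Complex.continuous_conj.comp (hc.comp (continuous_subtype_val.comp continuous_fst))).mul
        (hc'.comp (continuous_subtype_val.comp continuous_snd))
    · rw [norm_mul, Complex.norm_conj, hu, hu', one_mul]
  refine hbd.congr (Filter.Eventually.of_forall fun p => ?_)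
  show conj (R.chi p.1) * R.chi' p.2 * (R.chi p.1 * conj (R.chi' p.2) * Fo p) = Fo p
  have h1 : conj (R.chi p.1) * R.chi p.1 = 1 := by rw [Complex.conj_mul', hu]; norm_num
  have h2 : R.chi' p.2 * conj (R.chi' p.2) = 1 := by rw [mul_comm, Complex.conj_mul', hu']; norm_num
  calc conj (R.chi p.1) * R.chi' p.2 * (R.chi p.1 * conj (R.chi' p.2) * Fo p)
      = (conj (R.chi p.1) * R.chi p.1) * (R.chi' p.2 * conj (R.chi' p.2)) * Fo p := by ring
    _ = Fo p := by rw [h1, h2, one_mul, one_mul]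

/-- **The `T`-normalisation cancels**: `∫_{DZ_f × T′_f} Re (ffinLevel N)(b⁻¹ γ₀,f b′) ≥ 1` once `levelTf N ⊆ DZ_f` — the
integral over `levelTf × levelTf′ ⊆ {(b, b′) : b⁻¹ γ₀,f b′ ∈ K(N) γ₀,f K(N)}` is exactly `levelNorm⁻¹ · levelNorm = 1`. -/
theorem one_le_setIntegral_re_ffinLevel [νf.IsHaarMeasure] [νf'.IsHaarMeasure]
    (hc : Continuous R.chi) (hu : ∀ a, ‖R.chi a‖ = 1) (hc' : Continuous R.chi') (hu' : ∀ a, ‖R.chi' a‖ = 1)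
    (hN : N ≠ 0) (DZf : Set (torusFin W)) (hDZ : levelTf W N ⊆ DZf)
    (hint : IntegrableOn (fun p : torusFin W × torusFin' W => R.chi p.1 * conj (R.chi' p.2) *
      ffinLevel W νf νf' γ₀ N ((((p.1 : torusT W) : GA W))⁻¹ * GA.ofFinPart W γ₀ * ((p.2 : torusT' W) : GA W)))
      (DZf ×ˢ Set.univ) (νf.prod νf')) :
    1 ≤ ∫ p in DZf ×ˢ Set.univ,
      (ffinLevel W νf νf' γ₀ N ((((p.1 : torusT W) : GA W))⁻¹ * GA.ofFinPart W γ₀ * ((p.2 : torusT' W) : GA W))).re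
      ∂(νf.prod νf') := by
  haveI : BorelSpace (torusT W) := Subtype.borelSpace _
  haveI : BorelSpace (torusT' W) := Subtype.borelSpace _
  haveI : BorelSpace (torusFin W) := Subtype.borelSpace _
  haveI : BorelSpace (torusFin' W) := Subtype.borelSpace _
  haveI : SecondCountableTopology (torusFin W) := secondCountable_torusFin W
  haveI : SecondCountableTopology (torusFin' W) := secondCountable_torusFin' W
  haveI : LocallyCompactSpace (torusFin W) := locallyCompact_torusFin W
  haveI : LocallyCompactSpace (torusFin' W) := locallyCompact_torusFin' W
  haveI : IsLocallyFiniteMeasure νf := isLocallyFiniteMeasure_of_isFiniteMeasureOnCompacts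
  haveI : IsLocallyFiniteMeasure νf' := isLocallyFiniteMeasure_of_isFiniteMeasureOnCompacts
  haveI : SigmaFinite νf := sigmaFinite_of_locallyFinite
  haveI : SigmaFinite νf' := sigmaFinite_of_locallyFinite
  set Fo : torusFin W × torusFin' W → ℂ := fun p =>
    ffinLevel W νf νf' γ₀ N ((((p.1 : torusT W) : GA W))⁻¹ * GA.ofFinPart W γ₀ * ((p.2 : torusT' W) : GA W)) with hFo
  have hFoint : IntegrableOn Fo (DZf ×ˢ Set.univ) (νf.prod νf') :=
    integrableOn_ffinLevel_orbit_of_hint W νf νf' γ₀ N R hc hu hc' hu' DZf hint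
  have hsub : levelTf W N ×ˢ levelTf' W N ⊆ DZf ×ˢ Set.univ := Set.prod_mono hDZ (Set.subset_univ _)
  have hmeasL : MeasurableSet (levelTf W N ×ˢ levelTf' W N) :=
    (isOpen_levelTf W hN).measurableSet.prod (isOpen_levelTf' W hN).measurableSet
  have hone : ∫ p in levelTf W N ×ˢ levelTf' W N, (Fo p).re ∂(νf.prod νf') = 1 := by
    have hconst : ∀ p ∈ levelTf W N ×ˢ levelTf' W N, (Fo p).re = (levelNorm W νf νf' N)⁻¹ := by
      rintro ⟨b, b'⟩ ⟨hb, hb'⟩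
      show (ffinLevel W νf νf' γ₀ N _).re = _
      rw [ffinLevel_of_mem W νf νf' γ₀ N (orbit_mem_finitePart W γ₀ b b')
        (orbit_mem_levelDoubleCoset_of_mem W γ₀ N hb hb'), Complex.ofReal_re]
    rw [setIntegral_congr_fun hmeasL hconst, setIntegral_const, smul_eq_mul, measureReal_def, Measure.prod_prod,
      ENNReal.toReal_mul]
    exact mul_inv_cancel₀ (levelNorm_pos W νf νf' hN).ne'
  rw [← hone]
  refine setIntegral_mono_set hFoint.re ?_ (Filter.Eventually.of_forall hsub)
  exact Filter.Eventually.of_forall fun p => ffinLevel_re_nonneg W νf νf' γ₀ N hN _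

/-- **The finite main term of the natural witness is `≥ δ`, with NO volume input**: if the trace `levelTf N` lies in
`DZ_f` and `Re (χ(b) conj χ′(b′)) ≥ δ ≥ 0` wherever the witness does not vanish, then
`δ ≤ Re ∫_{DZ_f} χ(b) I_f(b) dν_f` for `F_f := ffinLevel N` (`re_setIntegral_chi_innerFin_ge` +
`one_le_setIntegral_re_ffinLevel`). -/
theorem re_setIntegral_chi_innerFin_ffinLevel_ge [νf.IsHaarMeasure] [νf'.IsHaarMeasure]
    (hc : Continuous R.chi) (hu : ∀ a, ‖R.chi a‖ = 1) (hc' : Continuous R.chi') (hu' : ∀ a, ‖R.chi' a‖ = 1)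
    (hN : N ≠ 0) (DZf : Set (torusFin W)) (hDZf : MeasurableSet DZf) (hDZ : levelTf W N ⊆ DZf)
    (δ : ℝ) (hδ0 : 0 ≤ δ)
    (hδ : ∀ b ∈ DZf, ∀ b' : torusFin' W,
      ffinLevel W νf νf' γ₀ N ((((b : torusT W) : GA W))⁻¹ * GA.ofFinPart W γ₀ * ((b' : torusT' W) : GA W)) ≠ 0 →
      δ ≤ (R.chi b * conj (R.chi' b')).re)
    (hint : IntegrableOn (fun p : torusFin W × torusFin' W => R.chi p.1 * conj (R.chi' p.2) *
      ffinLevel W νf νf' γ₀ N ((((p.1 : torusT W) : GA W))⁻¹ * GA.ofFinPart W γ₀ * ((p.2 : torusT' W) : GA W)))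
      (DZf ×ˢ Set.univ) (νf.prod νf')) :
    δ ≤ (∫ b in DZf, R.chi b * innerFin W R (ffinLevel W νf νf' γ₀ N) γ₀ νf' b ∂νf).re := by
  haveI : BorelSpace (torusT W) := Subtype.borelSpace _
  haveI : BorelSpace (torusT' W) := Subtype.borelSpace _
  have hmain := re_setIntegral_chi_innerFin_ge W R hc hu hc' hu' νf νf' (ffinLevel W νf νf' γ₀ N)
    (ffinLevel_im W νf νf' γ₀ N) (ffinLevel_re_nonneg W νf νf' γ₀ N hN) γ₀ DZf hDZf δ hδ hint
  have hge := one_le_setIntegral_re_ffinLevel W νf νf' γ₀ N R hc hu hc' hu' hN DZf hDZ hint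
  calc δ = δ * 1 := (mul_one δ).symm
    _ ≤ δ * ∫ p in DZf ×ˢ Set.univ,
        (ffinLevel W νf νf' γ₀ N ((((p.1 : torusT W) : GA W))⁻¹ * GA.ofFinPart W γ₀ * ((p.2 : torusT' W) : GA W))).re
        ∂(νf.prod νf') := mul_le_mul_of_nonneg_left hge hδ0
    _ ≤ _ := hmain

/-! ## The ONE display: the dimension count, and the `L¹` clause it discharges -/

/-- **THE DIMENSION COUNT (display)** — crit-1 Entry 119 (S15031): for a Haar measure `μ_f` on `G(𝔸_f)`, the measure of
the double coset `K(N) γ₀,f K(N)` is at most a constant times `ν_f(T_f ∩ K(N)) · ν′_f(T′_f ∩ K(N))`, uniformly in the level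
(`dim G = dim T + dim T′`: `vol K(N) ≍ N^{−4d}`, `vol (T ∩ K(N)) ≍ N^{−2d}`, the double-coset index bounded).  NOT proved here:
the local volumes of the congruence subgroups are an arithmetic input (a count lemma to land, not a print). -/
def LevelVolumeComparison (μfin : Measure (finitePart W)) : Prop :=
  ∃ M : ℝ, ∀ N : ℕ, N ≠ 0 →
    (μfin {g : finitePart W | (g : GA W) ∈ levelDoubleCoset W N (GA.ofFinPart W γ₀)}).toReal ≤
      M * levelNorm W νf νf' N

/-- **The `L¹` clause on the natural witness**: under the dimension count, `∫_{G(𝔸_f)} ‖ffinLevel N‖ dμ_f ≤ M` uniformly in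
the level (the witness is `levelNorm⁻¹` on the double coset and `0` elsewhere on `G(𝔸_f)`). -/
theorem integral_norm_ffinLevel_le [νf.IsHaarMeasure] [νf'.IsHaarMeasure] (μfin : Measure (finitePart W))
    (h : LevelVolumeComparison W νf νf' γ₀ μfin) :
    ∃ M : ℝ, ∀ N : ℕ, N ≠ 0 → ∫ g : finitePart W, ‖ffinLevel W νf νf' γ₀ N (g : GA W)‖ ∂μfin ≤ M := by
  haveI : T2Space (GA W) := t2Space_GA W
  haveI : BorelSpace (finitePart W) := Subtype.borelSpace _
  obtain ⟨M, hM⟩ := h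
  refine ⟨M, fun N hN => ?_⟩
  have hpos := levelNorm_pos W νf νf' hN
  have hmeas : MeasurableSet {g : finitePart W | (g : GA W) ∈ levelDoubleCoset W N (GA.ofFinPart W γ₀)} :=
    ((isCompact_levelDoubleCoset W hN _).isClosed.preimage continuous_subtype_val).measurableSet
  have hfun : (fun g : finitePart W => ‖ffinLevel W νf νf' γ₀ N (g : GA W)‖) =
      {g : finitePart W | (g : GA W) ∈ levelDoubleCoset W N (GA.ofFinPart W γ₀)}.indicator
        (fun _ => (levelNorm W νf νf' N)⁻¹) := by
    funext g
    by_cases hg : (g : GA W) ∈ levelDoubleCoset W N (GA.ofFinPart W γ₀)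
    · rw [Set.indicator_of_mem (show g ∈ {g : finitePart W | (g : GA W) ∈ levelDoubleCoset W N (GA.ofFinPart W γ₀)}
        from hg), ffinLevel_of_mem W νf νf' γ₀ N g.2 hg, Complex.norm_real, Real.norm_eq_abs,
        abs_of_nonneg (inv_pos.2 hpos).le]
    · rw [Set.indicator_of_notMem (show g ∉ {g : finitePart W | (g : GA W) ∈ levelDoubleCoset W N (GA.ofFinPart W γ₀)}
        from hg)]
      have h0 : ffinLevel W νf νf' γ₀ N (g : GA W) = 0 := by
        by_contra h0
        exact hg (mem_levelDoubleCoset_of_ffinLevel_ne_zero W νf νf' γ₀ N g.2 h0)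
      rw [h0, norm_zero]
  rw [hfun, integral_indicator hmeas, setIntegral_const, smul_eq_mul, measureReal_def]
  calc (μfin {g : finitePart W | (g : GA W) ∈ levelDoubleCoset W N (GA.ofFinPart W γ₀)}).toReal *
        (levelNorm W νf νf' N)⁻¹
      ≤ M * levelNorm W νf νf' N * (levelNorm W νf νf' N)⁻¹ :=
        mul_le_mul_of_nonneg_right (hM N hN) (inv_pos.2 hpos).le
    _ = M := mul_inv_cancel_right₀ hpos.ne' M

end Witness

end Summit.Ventures.HodgeRepro.Tier4.Line4

end
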